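import Literature.MathematicalPhysics.QuantumFieldTheory.Balaban1983to89.T4ContinuumYM4Torus

/-!
# Spine/NE7/IdentificationRoad — the rate-free alternative to node U5: IDENTIFICATION of the limit points (census R12) as a kernel
# face — «every subsequential limit functional satisfies a property with at most one solution» ⟹ `LimitPointsAgree`, and, for the
# countable bounded class, ⟹ `HasUniqueLimitPoints` ⟹ `HasContinuumLimit`; the d = 4 ABELIAN precedent in print (census R57)

Cell `pub-balaban-gaps` (YM blitz Y1, track G2, seat `ne7`, generation 9; text of record `run/shared/lean/pub/pub-balaban-gaps/ne/NE7.md`,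
census rows R12 «identification principle» and R57 «d = 4, G = U(1)»).  Bookkeeping ∕ [folklore] topology only (Bolzano–Weierstrass and a
diagonal extraction, both already in the tree: `Missing.exists_subseq_tendsto_of_bounded`, `T4Continuum.hasContinuumLimit_of_hasUniqueLimitPoints`);
no `def`; nothing printed is used as a hypothesis; 0 sorry; axioms standard.

WHAT.  Spine estimate NE7 (node U5: two-run matching modulo constants with a SUMMABLE rate) is the cell's SUFFICIENT mechanism for the
headline's limit clauses `HasContinuumLimit (D.scheme g₀) ∧ LimitPointsAgree (D.scheme g₀)` (`T4ContinuumYM4Torus.ContinuumYM4Torus`, first two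
conjuncts); it is not necessary.  Besides the roads that COMPARE runs or cutoffs (U5∕U6, and the census's rate-free pairwise variant R10 and
law-level variant R11), the census records one road that compares nothing — IDENTIFICATION (R12): exhibit a property `P` of functionals on
label strings with AT MOST ONE solution and show that EVERY subsequential limit functional of the joint expectations has it — then all limit
points agree with no rate at all, and (countable labels, expectations bounded by `1`: the averaged-loop class) every joint expectation
converges along the full sequence.  This file is that road's END FACE by name:
* §1 `limitPointsAgree_of_identification` (any scheme, any label type) and the special case `limitPointsAgree_of_limitPoints_eq` (every
  subsequential limit functional equals one given candidate `E₀` — the shape of the abelian precedent below);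
* §2 `exists_isLimitFunctional_along` (countably many labels, bounded expectations: along ANY subsequence a further subsequence carries a
  limit FUNCTIONAL — the tree's Tychonoff step `Missing.exists_subseq_tendsto_of_bounded` replayed along `φ`),
  `hasUniqueLimitPoints_of_identification`, `hasContinuumLimit_of_identification`;
* §2b `limitPointsAgree_of_lawIdentification` — the same in MEASURE form (subsequential weak limits of the laws of the observable vector on
  the cube `[−1,1]^𝒪`, `T4LimitLaw.law`; one direction of `T4LimitLaw.limitPointsAgree_iff_subseq_limitLaw_unique`) — the form print uses;
* §3 `forSmallCouplings_limit_of_identification` — for a finite-ε datum `D` (class `𝒪 = ULoop F`, countable; `|⟨∏⟩| ≤ 1`,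
  `abs_expectAt_le_one`): identification data under the discharged prefix ⟹ the headline's two limit conjuncts under the prefix,
  WITHOUT node U5 ∕ U6 (no `MatchingModConstants`, no `GenFunCauchy`).

THE PRINTED PRECEDENT IN d = 4 (census R57, read as printed; context only, nothing of it is used): B. K. Driver, «Convergence of the U(1)₄
lattice gauge theory to its continuum limit», Commun. Math. Phys. 110 (1987) 479–501 — compact U(1) on ℤ⁴ with a general energy function
`h`, coupling FIXED («This is an exceptional case, since the lattice approximating Gibbs state … no longer depends on the lattice spacing
parameter (a)», p. 484): Thm 4.2 p. 484 «Suppose that G(g⁻²h) = {μ} is a one element set. Then for any closed complex test 2-form (φ) on ℝ⁴,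
lim_{a↓0} μ(e^{(F,φ_a)}) = [the right side of (4.2), the free field's Laplace transform]» with «α = μ(h″(ω(dp))) ≥ 0», i.e. «the Laplace transforms of the lattice current converges
to the corresponding Laplace transforms of the free Euclidean field … provided the coupling constant (g²) is renormalised by the factor α»;
Lemma 4.1 p. 485 (uniqueness of the Gibbs state for `[sup h − inf h] < 2g²∕9`), Thm 4.3 (extreme invariant states), Thm 4.5 (Wilson-like
`h`, all but countably many `g`); method: Schwinger–Dyson equations + extreme Gibbs states (p. 480), NO renormalisation group, NO two-cutoff
rate; d = 3: L. Gross, Commun. Math. Phys. 92 (1983) (cited there).  In the language of this file: `P E :=` «`E`'s Laplace transforms on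
the current sector are those of the free field at the `α`-renormalised coupling» has one solution and every limit point has it.  WHY IT DOES NOT
TRANSFER (census R12's reason, unchanged): for SU(N) on T⁴ no characterising property of the would-be limit with a uniqueness theorem is
known (no Gaussian target; loop equations ∕ stochastic quantisation ∕ OS data carry no uniqueness theorem in d = 4) — [Rivasseau1991] p. 287,
[MagnenRivasseauSeneor1993] p. 326.  Two STRUCTURAL features of NE7's statement nevertheless appear in that print: SMEARED observables
(test forms on the current sector; the tree's class is block-AVERAGED loops, `FiniteEpsData.avgObs`) and a FINITE COUPLING RENORMALISATION
read off the lattice state (`α`; the abelian shadow of node U2's `hpin`).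

HONEST FRAMING.  A road SHAPE and its elementary end face; the road is NOT walked for Bałaban's datum (no `P` is proposed); NE7 is NOT
proved and not bypassed; spine 0∕9; one fixed finite T⁴, rung (B)+1 — NOT ℝ⁴, NOT infinite volume, NOT a mass gap, NOT Clay.  HONEST
DEPENDENCY: continuum YM on T⁴ ⇐ (B) ∧ β-input ∧ nine spine estimates (0∕9 proved); this file changes no census value.
-/

noncomputable section

open Filter Topology

namespace Summit.QuantumFields.BalabanUV.T4Continuum.Spine.NE7

open Literature.MathematicalPhysics.QuantumFieldTheory.Balaban1983to89
open Literature.MathematicalPhysics.QuantumFieldTheory.Balaban1983to89.Missing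
open Literature.MathematicalPhysics.QuantumFieldTheory.Balaban1983to89.T4Continuum
open Literature.MathematicalPhysics.QuantumFieldTheory.Balaban1983to89.T4ContinuumYM4Torus

/-! ## §1 Identification ⟹ the limit points agree (functional form, any scheme) -/

section Functional

variable {G : Type*} [GaugeGroup G] [MeasurableSpace G] [HaarData G] {O : Type*}

/-- [folklore] **IDENTIFICATION ⟹ `LimitPointsAgree`.**  If a property `P` of functionals on label strings has at most one solution and
every subsequential limit functional of the joint expectations of `S` has `P`, then any two subsequential limit functionals agree.  No rate,
no estimate: pure logic. [folklore] -/
theorem limitPointsAgree_of_identification (S : TorusScheme G O) {P : (List O → ℝ) → Prop}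
    (huniq : ∀ E E' : List O → ℝ, P E → P E' → E = E')
    (hall : ∀ (φ : ℕ → ℕ) (E : List O → ℝ), StrictMono φ → IsLimitFunctional (fun K => S.expectAt (φ K)) E → P E) :
    LimitPointsAgree S := fun φ ψ E E' hφ hψ hE hE' =>
  huniq E E' (hall φ E hφ hE) (hall ψ E' hψ hE')

/-- [folklore] The special case of an EXPLICITLY IDENTIFIED limit (the shape of [Driver1987] Thm 4.2: every limit point equals the free
field's functional at the renormalised coupling): if every subsequential limit functional equals one candidate `E₀`, the limit points agree.
[folklore] -/
theorem limitPointsAgree_of_limitPoints_eq (S : TorusScheme G O) (E₀ : List O → ℝ)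
    (hall : ∀ (φ : ℕ → ℕ) (E : List O → ℝ), StrictMono φ → IsLimitFunctional (fun K => S.expectAt (φ K)) E → E = E₀) :
    LimitPointsAgree S :=
  limitPointsAgree_of_identification S (P := fun E => E = E₀) (fun _ _ h h' => h.trans h'.symm) hall

end Functional

/-! ## §2 Countable bounded class: identification ⟹ unique limit points label by label ⟹ full convergence -/

section Countable

variable {G : Type*} [GaugeGroup G] [MeasurableSpace G] [HaarData G] {O : Type*} [Countable O]

/-- [folklore] **A LIMIT FUNCTIONAL ALONG A FURTHER SUBSEQUENCE OF ANY SUBSEQUENCE** (countably many labels, expectations bounded by `M`):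
Tychonoff in `[−M, M]^ℕ` — the tree's `Missing.exists_subseq_tendsto_of_bounded` applied to the expectations re-indexed along `φ`.
[folklore] -/
theorem exists_isLimitFunctional_along (S : TorusScheme G O) {M : ℝ} (hb : ∀ K os, |S.expectAt K os| ≤ M) (φ : ℕ → ℕ) :
    ∃ (θ : ℕ → ℕ) (E : List O → ℝ), StrictMono θ ∧ IsLimitFunctional (fun K => S.expectAt (φ (θ K))) E := by
  classical
  obtain ⟨e, he⟩ := exists_surjective_nat (Option (List O))
  let X : ℕ → ℕ → ℝ := fun i K => match e i with
    | some os => S.expectAt (φ K) os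
    | none => 0
  have hX : ∀ i K, |X i K| ≤ M := by
    intro i K
    have hM : 0 ≤ M := (abs_nonneg _).trans (hb 0 [])
    simp only [X]
    split
    · exact hb _ _
    · simpa using hM
  obtain ⟨θ, hθ, hlim⟩ := exists_subseq_tendsto_of_bounded X M hX
  choose l _ hl using hlim
  refine ⟨θ, fun os => l (Classical.choose (he (some os))), hθ, fun os => ?_⟩
  have hi := Classical.choose_spec (he (some os))
  have h := hl (Classical.choose (he (some os)))
  simpa [X, hi] using h

/-- [folklore] **IDENTIFICATION ⟹ `HasUniqueLimitPoints`** (label by label) for countably many labels with bounded expectations: a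
subsequential limit `l` of ONE label's expectations along `φ` is the value at that label of a limit FUNCTIONAL along a further subsequence
(`exists_isLimitFunctional_along`), which has `P`; two such functionals coincide. [folklore] -/
theorem hasUniqueLimitPoints_of_identification (S : TorusScheme G O) {M : ℝ} (hb : ∀ K os, |S.expectAt K os| ≤ M)
    {P : (List O → ℝ) → Prop} (huniq : ∀ E E' : List O → ℝ, P E → P E' → E = E')
    (hall : ∀ (φ : ℕ → ℕ) (E : List O → ℝ), StrictMono φ → IsLimitFunctional (fun K => S.expectAt (φ K)) E → P E) :
    HasUniqueLimitPoints S := by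
  intro os φ ψ hφ hψ l l' hl hl'
  obtain ⟨θ, E, hθ, hE⟩ := exists_isLimitFunctional_along S hb φ
  obtain ⟨θ', E', hθ', hE'⟩ := exists_isLimitFunctional_along S hb ψ
  have hPE : P E := hall (φ ∘ θ) E (hφ.comp hθ) hE
  have hPE' : P E' := hall (ψ ∘ θ') E' (hψ.comp hθ') hE'
  have h1 : l = E os := tendsto_nhds_unique (hl.comp hθ.tendsto_atTop) (hE os)
  have h2 : l' = E' os := tendsto_nhds_unique (hl'.comp hθ'.tendsto_atTop) (hE' os)
  rw [h1, h2, huniq E E' hPE hPE']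

/-- [folklore] **IDENTIFICATION ⟹ `HasContinuumLimit`** (full-sequence convergence of every joint expectation) for countably many labels
with bounded expectations — by `hasUniqueLimitPoints_of_identification` and the tree's Bolzano–Weierstrass step
`T4Continuum.hasContinuumLimit_of_hasUniqueLimitPoints`.  This is the rate-free road to the conclusion node U5∕U6 reach through
`MatchingModConstants ∧ Summable δ` and `GenFunCauchy`. [folklore] -/
theorem hasContinuumLimit_of_identification (S : TorusScheme G O) {M : ℝ} (hb : ∀ K os, |S.expectAt K os| ≤ M)
    {P : (List O → ℝ) → Prop} (huniq : ∀ E E' : List O → ℝ, P E → P E' → E = E')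
    (hall : ∀ (φ : ℕ → ℕ) (E : List O → ℝ), StrictMono φ → IsLimitFunctional (fun K => S.expectAt (φ K)) E → P E) :
    HasContinuumLimit S :=
  hasContinuumLimit_of_hasUniqueLimitPoints S (fun os => ⟨M, fun K => hb K os⟩)
    (hasUniqueLimitPoints_of_identification S hb huniq hall)

end Countable

/-! ## §2b Law form: identification of the subsequential weak limits of the LAWS (the shape print uses) -/

section LawForm

variable {G : Type*} {O : Type*} [Countable O] (S : TorusScheme G O) [MeasurableSpace G] [GaugeGroup G]
  [RegularGaugeGroup G] [HaarData G] (hβ : ∀ K, 0 ≤ S.β K) (hm : ∀ K o, Measurable (S.obs K o))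

/-- [folklore] **IDENTIFICATION IN MEASURE FORM ⟹ `LimitPointsAgree`**: for a scheme with `β_K ≥ 0` and countably many measurable
observables bounded by `1`, if a property `P` of Borel probability measures on the observable cube `[−1,1]^𝒪` has at most one solution
and every subsequential WEAK LIMIT of the laws `T4LimitLaw.law S hβ hm K` (the joint law of the observable vector under the `K`-th Gibbs
measure) has `P`, then all subsequential limit functionals agree — the tree's `T4LimitLaw.limitPointsAgree_iff_subseq_limitLaw_unique` read
in one direction.  This is the form of [Driver1987] Thm 4.2 (identification of the limit MEASURE through its Laplace transforms). [folklore] -/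
theorem limitPointsAgree_of_lawIdentification (h1 : ∀ K o U, |S.obs K o U| ≤ 1)
    {P : MeasureTheory.ProbabilityMeasure (T4LimitLaw.Cube O) → Prop} (huniq : ∀ ν ν', P ν → P ν' → ν = ν')
    (hall : ∀ (φ : ℕ → ℕ) (ν : MeasureTheory.ProbabilityMeasure (T4LimitLaw.Cube O)), StrictMono φ →
      Tendsto (fun n => T4LimitLaw.law S hβ hm (φ n)) atTop (𝓝 ν) → P ν) :
    LimitPointsAgree S :=
  (T4LimitLaw.limitPointsAgree_iff_subseq_limitLaw_unique S hβ hm h1).mpr fun φ ψ ν ν' hφ hψ hν hν' =>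
    huniq ν ν' (hall φ ν hφ hν) (hall ψ ν' hψ hν')

end LawForm

/-! ## §3 The identification road under the discharged prefix of rung (B)+1 -/

section Prefix

universe u

variable {F : T4Family} {G : Type u} [GaugeGroup G] [MeasurableSpace G] [HaarData G] [RegularGaugeGroup G]

/-- [folklore] **THE IDENTIFICATION ROAD'S END FACE FOR A FINITE-ε DATUM.**  If, for all small `γ`, `g` and every tuned bare-coupling
sequence `g₀` (the discharged prefix `ForSmallCouplings`), SOME property `P` of functionals on loop strings with at most one solution is
enjoyed by every subsequential limit functional of the Wilson scheme `D.scheme g₀`, then the headline's two LIMIT conjuncts —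
`HasContinuumLimit (D.scheme g₀) ∧ LimitPointsAgree (D.scheme g₀)` — hold under the same prefix (the class `ULoop F` is countable and
`|⟨∏⟩| ≤ 1`, `abs_expectAt_le_one`).  Reflection positivity and torus covariance of the limit points (the other two conjuncts of
`ContinuumYM4Torus`) are the tree's separate theorems and are not touched.  A road SHAPE: no `P` is proposed for Bałaban's datum —
[Driver1987] supplies one for compact U(1)₄ on ℤ⁴ only. [folklore] -/
theorem forSmallCouplings_limit_of_identification (D : FiniteEpsData F G)
    (h : ForSmallCouplings D fun g₀ => ∃ P : (List (ULoop F) → ℝ) → Prop,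
      (∀ E E' : List (ULoop F) → ℝ, P E → P E' → E = E') ∧
        ∀ (φ : ℕ → ℕ) (E : List (ULoop F) → ℝ), StrictMono φ →
          IsLimitFunctional (fun K => (D.scheme g₀).expectAt (φ K)) E → P E) :
    ForSmallCouplings D fun g₀ => HasContinuumLimit (D.scheme g₀) ∧ LimitPointsAgree (D.scheme g₀) :=
  h.mono fun g₀ ⟨_, huniq, hall⟩ =>
    ⟨hasContinuumLimit_of_identification (D.scheme g₀) (M := 1) (fun K os => D.abs_expectAt_le_one g₀ K os) huniq hall,
      limitPointsAgree_of_identification (D.scheme g₀) huniq hall⟩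

end Prefix

end Summit.QuantumFields.BalabanUV.T4Continuum.Spine.NE7

end
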